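import Literature.Analysis.FluidPDE.TaoCascadeRescaledBootstrap
import HarnessLib

/-!
# Tao's cascade ODE, §6.6: Prop. 6.12 from Prop. 6.15 and Prop. 6.13 (the choice `μ₁ := a₁(τ₁)`)

T. Tao, *Finite time blowup for an averaged three-dimensional Navier–Stokes equation*,
J. Amer. Math. Soc. 29 (2016), 601–674 = arXiv:1402.0290v3, §6.5 (after Prop. 6.12: "the
remaining claims … of Proposition 6.5 follow for `τ₁` obeying (6.106) from (6.92)–(6.95)") and
§6.6 (after Prop. 6.15: "Indeed, Proposition 6.12 follows from Proposition 6.15 and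
Proposition 6.13 once we set `μ₁ := a₁(τ₁)` (and take `K` sufficiently large, `ε` sufficiently
small, and `n₀` sufficiently large)").

This file proves that bookkeeping step once, in a packaging-neutral form: given a time
`1/100 ≤ τ₁ ≤ 100`, the bootstrap bounds (6.92)–(6.95) (`GoodAt`, landed in
`TaoCascadeRescaledBootstrap.lean`) on `[0, τ₁]`, the six state bounds (6.139)–(6.144) of the
conclusion of Prop. 6.15 at `τ₁`, and the bounds of Prop. 6.13 on `b₁(τ₁), c₁(τ₁)` already
weakened by the factor `(1+ε₀)^{-1/100}` that "`K` sufficiently large … `n₀` sufficiently large"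
buys, the full conclusion (6.67)–(6.81) of Prop. 6.5 (`RescaledConclusion γ`, landed in
`TaoCascadeRescaled.lean`) holds with `μ₁ := a₁(τ₁)` — for any coefficient `γ ≥ 0` in (6.71)
(printed `10⁻⁵ exp(-K¹⁰)`, corrected `10⁻⁵ exp(-K¹⁰/2)`). Everything is proved; the only
analysis is `½ ≤ (1+ε₀)^{-1/100} ≤ μ₁ ≤ (1+ε₀)^{1/100} ≤ 2`.

## References

* T. Tao, J. Amer. Math. Soc. 29 (2016), 601–674 = arXiv:1402.0290v3, §6.4 Prop. 6.5
  (6.67)–(6.81), §6.5 Prop. 6.12 and the sentence following it, §6.6 Props. 6.13, 6.15 and the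
  sentence following Prop. 6.15. [`Tao2016AveragedNS`]
-/

noncomputable section

open Set

namespace Literature.Analysis.FluidPDE

namespace TaoCascade

section Glue

variable {γ ε₀ K ε : ℝ} {n₀ : ℤ} {Y : Fin 4 → ℤ → ℝ → ℝ} {F : ℤ → ℝ → ℝ} {τ₁ : ℝ}

/-- `(1+ε₀)^{1/100} ≤ 2` for `0 < ε₀ < 1`. [folklore] -/
theorem rpow_hundredth_le_two (hε₀ : 0 < ε₀) (hε₀1 : ε₀ < 1) :
    (1 + ε₀) ^ ((1 : ℝ) / 100) ≤ 2 := by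
  calc (1 + ε₀) ^ ((1 : ℝ) / 100) ≤ (2 : ℝ) ^ ((1 : ℝ) / 100) :=
        Real.rpow_le_rpow (by linarith) (by linarith) (by norm_num)
    _ ≤ (2 : ℝ) ^ (1 : ℝ) := Real.rpow_le_rpow_of_exponent_le (by norm_num) (by norm_num)
    _ = 2 := Real.rpow_one 2

/-- `1/2 ≤ (1+ε₀)^{-1/100}` for `0 < ε₀ < 1`. [folklore] -/
theorem half_le_rpow_neg_hundredth (hε₀ : 0 < ε₀) (hε₀1 : ε₀ < 1) :
    1 / 2 ≤ (1 + ε₀) ^ (-(1 : ℝ) / 100) := by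
  rw [show -(1 : ℝ) / 100 = -((1 : ℝ) / 100) by ring, Real.rpow_neg (by linarith), one_div]
  exact inv_anti₀ (Real.rpow_pos_of_pos (by linarith) _) (rpow_hundredth_le_two hε₀ hε₀1)

/-- `(1+ε₀)^{1/100} ≤ 4/3` for `0 < ε₀ < 1` (as `2 ≤ (4/3)^{100}`). [folklore] -/
theorem rpow_hundredth_le_four_thirds (hε₀ : 0 < ε₀) (hε₀1 : ε₀ < 1) :
    (1 + ε₀) ^ ((1 : ℝ) / 100) ≤ 4 / 3 := by
  have h43 : (4 / 3 : ℝ) = ((4 / 3 : ℝ) ^ (100 : ℕ)) ^ ((100 : ℕ) : ℝ)⁻¹ :=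
    (Real.pow_rpow_inv_natCast (by norm_num) (by norm_num)).symm
  have h2 : (2 : ℝ) ≤ (4 / 3 : ℝ) ^ (100 : ℕ) := by norm_num
  calc (1 + ε₀) ^ ((1 : ℝ) / 100) ≤ (2 : ℝ) ^ ((1 : ℝ) / 100) :=
        Real.rpow_le_rpow (by linarith) (by linarith) (by norm_num)
    _ ≤ ((4 / 3 : ℝ) ^ (100 : ℕ)) ^ ((1 : ℝ) / 100) :=
        Real.rpow_le_rpow (by norm_num) h2 (by norm_num)
    _ = 4 / 3 := by rw [show (1 : ℝ) / 100 = ((100 : ℕ) : ℝ)⁻¹ by norm_num, ← h43]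

/-- `3/4 ≤ (1+ε₀)^{-1/100}` for `0 < ε₀ < 1`. [folklore] -/
theorem three_quarters_le_rpow_neg_hundredth (hε₀ : 0 < ε₀) (hε₀1 : ε₀ < 1) :
    3 / 4 ≤ (1 + ε₀) ^ (-(1 : ℝ) / 100) := by
  rw [show -(1 : ℝ) / 100 = -((1 : ℝ) / 100) by ring, Real.rpow_neg (by linarith),
    show (3 / 4 : ℝ) = (4 / 3)⁻¹ by norm_num]
  exact inv_anti₀ (Real.rpow_pos_of_pos (by linarith) _) (rpow_hundredth_le_four_thirds hε₀ hε₀1)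

/-- `(1+ε₀)^{-1/100} ≤ 1`. [folklore] -/
theorem rpow_neg_hundredth_le_one (hε₀ : 0 < ε₀) : (1 + ε₀) ^ (-(1 : ℝ) / 100) ≤ 1 :=
  Real.rpow_le_one_of_one_le_of_nonpos (by linarith) (by norm_num)

/-- **Prop. 6.12 ⇐ Prop. 6.15 + Prop. 6.13, with `μ₁ := a₁(τ₁)`.** Let `0 < ε₀ < 1`, `K > 0`,
`ε > 0`, `γ ≥ 0`, and `1/100 ≤ τ₁ ≤ 100`. Suppose the bootstrap bounds (6.92)–(6.95) hold on
`[0, τ₁]` (`GoodAt`), the state bounds (6.139)–(6.144) of Prop. 6.15 hold at `τ₁`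
(`(1+ε₀)^{-1/100} ≤ a₁(τ₁) ≤ (1+ε₀)^{1/100}`, `2·10⁻⁵ε ≤ b₀(τ₁) ≤ ½10⁵ε`,
`2e^{K⁹}ε² ≤ c₀(τ₁) ≤ ½e^{K¹⁰}ε²`, `Ẽ₀(τ₁) ≤ ½K⁻²⁰`), and the Prop. 6.13 bounds at `τ₁` in the
form `|b₁(τ₁)| ≤ 10⁻⁵ε(1+ε₀)^{-1/100}`, `|c₁(τ₁)| ≤ γ ε²(1+ε₀)^{-1/100}`,
`c₁(τ₁) ≥ -(1+ε₀)^{-n₀/4}(1+ε₀)^{-1/100}` (i.e. after "taking `K` sufficiently large … `n₀`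
sufficiently large"). Then (6.67)–(6.81) hold with `μ₁ = a₁(τ₁)`: `RescaledConclusion γ`.
[cite: Tao2016AveragedNS, §6.6 after Prop. 6.15; §6.5 after Prop. 6.12] -/
theorem RescaledConclusion.of_state (hε₀ : 0 < ε₀) (hε₀1 : ε₀ < 1) (hK : 0 < K) (hε : 0 < ε)
    (hγ : 0 ≤ γ) (hτ₁ : 1 / 100 ≤ τ₁) (hτ₁' : τ₁ ≤ 100)
    (hgood : ∀ t ∈ Icc 0 τ₁, GoodAt ε₀ K Y F t)
    (ha_ge : (1 + ε₀) ^ (-(1 : ℝ) / 100) ≤ Y 0 1 τ₁) (ha_le : Y 0 1 τ₁ ≤ (1 + ε₀) ^ ((1 : ℝ) / 100))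
    (hb_ge : 2 / 10 ^ 5 * ε ≤ Y 1 0 τ₁) (hb_le : Y 1 0 τ₁ ≤ 10 ^ 5 / 2 * ε)
    (hc_ge : 2 * Real.exp (K ^ 9) * ε ^ 2 ≤ Y 2 0 τ₁)
    (hc_le : Y 2 0 τ₁ ≤ Real.exp (K ^ 10) / 2 * ε ^ 2) (hE : F 0 τ₁ ≤ 1 / 2 * (K ^ 20)⁻¹)
    (hb1 : |Y 1 1 τ₁| ≤ 1 / 10 ^ 5 * ε * (1 + ε₀) ^ (-(1 : ℝ) / 100))
    (hc1 : |Y 2 1 τ₁| ≤ γ * ε ^ 2 * (1 + ε₀) ^ (-(1 : ℝ) / 100))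
    (hc1_ge : -((1 + ε₀) ^ (-(n₀ : ℝ) / 4) * (1 + ε₀) ^ (-(1 : ℝ) / 100)) ≤ Y 2 1 τ₁) :
    RescaledConclusion γ ε₀ K ε n₀ Y F τ₁ (Y 0 1 τ₁) := by
  set μ₁ := Y 0 1 τ₁ with hμ₁
  have hq0 : (0 : ℝ) < 1 + ε₀ := by linarith
  have hhalf := half_le_rpow_neg_hundredth hε₀ hε₀1
  have htwo := rpow_hundredth_le_two hε₀ hε₀1
  have h34 := three_quarters_le_rpow_neg_hundredth hε₀ hε₀1
  have hμ_half : 1 / 2 ≤ μ₁ := hhalf.trans ha_ge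
  have hμ_34 : 3 / 4 ≤ μ₁ := h34.trans ha_ge
  have hμ_two : μ₁ ≤ 2 := ha_le.trans htwo
  have hμ0 : 0 ≤ μ₁ := by linarith
  have hK10 : 0 < (K ^ 10)⁻¹ := by positivity
  have hK20 : 0 < (K ^ 20)⁻¹ := by positivity
  have hq4 : 0 ≤ (1 + ε₀) ^ (-(n₀ : ℝ) / 4) := Real.rpow_nonneg hq0.le _
  have hτ₁0 : (0 : ℝ) ≤ τ₁ := by linarith
  have hgτ := hgood τ₁ ⟨hτ₁0, le_rfl⟩
  refine
    { tau_ge := hτ₁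
      tau_le := hτ₁'
      mu_ge := ha_ge
      mu_le := ha_le
      a_eq := rfl
      b_abs_le := hb1.trans (by gcongr)
      c_abs_le := hc1.trans (by gcongr)
      c_ge := le_trans (by gcongr) hc1_ge
      d_abs_le := ?_
      energy_le := ?_
      b_prev_ge := ?_
      b_prev_le := ?_
      c_prev_ge := ?_
      c_prev_le := ?_
      en_before := fun m hm t ht => (hgood t ht).before m hm
      en_during := fun t ht => (hgood t ht).during
      en_after := fun m hm t ht => (hgood t ht).after m hm }
  · -- (6.73) from (6.95)
    calc |Y 3 1 τ₁| ≤ 1 / 2 * (K ^ 10)⁻¹ := hgτ.d_le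
      _ = (K ^ 10)⁻¹ * (1 / 2) := by ring
      _ ≤ (K ^ 10)⁻¹ * μ₁ := by gcongr
  · -- (6.74) from (6.144)
    have : 1 / 2 ≤ μ₁ ^ 2 := by nlinarith [mul_le_mul hμ_34 hμ_34 (by norm_num) hμ0]
    calc F 0 τ₁ ≤ 1 / 2 * (K ^ 20)⁻¹ := hE
      _ = (K ^ 20)⁻¹ * (1 / 2) := by ring
      _ ≤ (K ^ 20)⁻¹ * μ₁ ^ 2 := by gcongr
  · -- (6.75) from (6.140)
    calc 1 / 10 ^ 5 * ε * μ₁ ≤ 1 / 10 ^ 5 * ε * 2 := by gcongr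
      _ = 2 / 10 ^ 5 * ε := by ring
      _ ≤ Y 1 0 τ₁ := hb_ge
  · -- (6.76) from (6.141)
    calc Y 1 0 τ₁ ≤ 10 ^ 5 / 2 * ε := hb_le
      _ = 10 ^ 5 * ε * (1 / 2) := by ring
      _ ≤ 10 ^ 5 * ε * μ₁ := by gcongr
  · -- (6.77) from (6.142)
    calc Real.exp (K ^ 9) * ε ^ 2 * μ₁ ≤ Real.exp (K ^ 9) * ε ^ 2 * 2 := by gcongr
      _ = 2 * Real.exp (K ^ 9) * ε ^ 2 := by ring
      _ ≤ Y 2 0 τ₁ := hc_ge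
  · -- (6.78) from (6.143)
    calc Y 2 0 τ₁ ≤ Real.exp (K ^ 10) / 2 * ε ^ 2 := hc_le
      _ = Real.exp (K ^ 10) * ε ^ 2 * (1 / 2) := by ring
      _ ≤ Real.exp (K ^ 10) * ε ^ 2 * μ₁ := by gcongr

/-- The same glue with the Prop. 6.13 bounds in their natural form `|b₁(τ₁)| ≤ B_b ε`,
`|c₁(τ₁)| ≤ B_c ε²`, `c₁(τ₁) ≥ -η`, and the parameter largeness spelled out as the three
inequalities `B_b ≤ 10⁻⁵/2`, `B_c ≤ γ/2`, `η ≤ ½(1+ε₀)^{-n₀/4}` (using `(1+ε₀)^{-1/100} ≥ ½`).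
[cite: Tao2016AveragedNS, §6.6 after Prop. 6.15] -/
theorem RescaledConclusion.of_state' (hε₀ : 0 < ε₀) (hε₀1 : ε₀ < 1) (hK : 0 < K) (hε : 0 < ε)
    (hγ : 0 ≤ γ) (hτ₁ : 1 / 100 ≤ τ₁) (hτ₁' : τ₁ ≤ 100)
    (hgood : ∀ t ∈ Icc 0 τ₁, GoodAt ε₀ K Y F t)
    (ha_ge : (1 + ε₀) ^ (-(1 : ℝ) / 100) ≤ Y 0 1 τ₁) (ha_le : Y 0 1 τ₁ ≤ (1 + ε₀) ^ ((1 : ℝ) / 100))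
    (hb_ge : 2 / 10 ^ 5 * ε ≤ Y 1 0 τ₁) (hb_le : Y 1 0 τ₁ ≤ 10 ^ 5 / 2 * ε)
    (hc_ge : 2 * Real.exp (K ^ 9) * ε ^ 2 ≤ Y 2 0 τ₁)
    (hc_le : Y 2 0 τ₁ ≤ Real.exp (K ^ 10) / 2 * ε ^ 2) (hE : F 0 τ₁ ≤ 1 / 2 * (K ^ 20)⁻¹)
    {Bb Bc η : ℝ} (hb1 : |Y 1 1 τ₁| ≤ Bb * ε) (hc1 : |Y 2 1 τ₁| ≤ Bc * ε ^ 2)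
    (hc1_ge : -η ≤ Y 2 1 τ₁) (hBb : Bb ≤ 1 / 10 ^ 5 / 2) (hBc : Bc ≤ γ / 2)
    (hη : η ≤ 1 / 2 * (1 + ε₀) ^ (-(n₀ : ℝ) / 4)) :
    RescaledConclusion γ ε₀ K ε n₀ Y F τ₁ (Y 0 1 τ₁) := by
  have hq0 : (0 : ℝ) < 1 + ε₀ := by linarith
  have hhalf := half_le_rpow_neg_hundredth hε₀ hε₀1
  have hq4 : 0 ≤ (1 + ε₀) ^ (-(n₀ : ℝ) / 4) := Real.rpow_nonneg hq0.le _
  have hq1 : 0 ≤ (1 + ε₀) ^ (-(1 : ℝ) / 100) := Real.rpow_nonneg hq0.le _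
  refine RescaledConclusion.of_state hε₀ hε₀1 hK hε hγ hτ₁ hτ₁' hgood ha_ge ha_le hb_ge hb_le hc_ge
    hc_le hE ?_ ?_ ?_
  · calc |Y 1 1 τ₁| ≤ Bb * ε := hb1
      _ ≤ 1 / 10 ^ 5 / 2 * ε := by gcongr
      _ = 1 / 10 ^ 5 * ε * (1 / 2) := by ring
      _ ≤ 1 / 10 ^ 5 * ε * (1 + ε₀) ^ (-(1 : ℝ) / 100) := by gcongr
  · calc |Y 2 1 τ₁| ≤ Bc * ε ^ 2 := hc1
      _ ≤ γ / 2 * ε ^ 2 := by gcongr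
      _ = γ * ε ^ 2 * (1 / 2) := by ring
      _ ≤ γ * ε ^ 2 * (1 + ε₀) ^ (-(1 : ℝ) / 100) := by gcongr
  · have : (1 + ε₀) ^ (-(n₀ : ℝ) / 4) * (1 + ε₀) ^ (-(1 : ℝ) / 100) ≥
        (1 + ε₀) ^ (-(n₀ : ℝ) / 4) * (1 / 2) := by gcongr
    linarith

end Glue

end TaoCascade

end Literature.Analysis.FluidPDE
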